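import Literature.Analysis.FluidPDE.NSBoundedMildOseenDuhamel
import Mathlib.Analysis.Calculus.LineDeriv.IntegrationByParts
import HarnessLib

/-!
# The tested form of a divergence force `-div G` is reproduced by the Oseen–Duhamel pairs
  `(eⱼ, Gᵢⱼ eᵢ)`

Analysis/FluidPDE support file (everything proved) for the perturbation step of M. P. Coiculescu,
S. Palasek, *Non-uniqueness of smooth solutions of the Navier–Stokes equations from critical data*,
Invent. Math. 244 (2025) = arXiv:2503.14699, §4.1 eq. (4.1) (the principal part solves (NSE) with
the residual force `-ℙ div F`) and §5 ¶1. It supplies the hypothesis `hpair` of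
`exists_const_forced_oseenMild_of_bounded_isMildNSSolutionOn` (sibling file
`ForcedOseenMildUpToConst`): for a bounded `C¹` tensor field `G(τ, y)` with bounded space
derivative, the force `f = -div G`, `fᵢ = -Σⱼ ∂ⱼ Gᵢⱼ`, tested against the caloric test field
`e^{ν(t-τ)Δ}φ` of a divergence-free test field `φ`, equals minus the sum over `(i, j)` of the
tested Oseen–Duhamel pairs `B^ν_0(eⱼ, Gᵢⱼ eᵢ)(t)`:

* `integral_fderiv_mul_eq_neg_of_bounded` — whole-space integration by parts `∫ ∂ᵥg · h = -∫ g · ∂ᵥh`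
  for a bounded `C¹` factor `g` with bounded derivative and an integrable `C¹` factor `h` with
  integrable directional derivative (Mathlib's `integral_mul_fderiv_eq_neg_fderiv_mul_of_integrable`);
* `integral_inner_negMatrixDiv_eq_sum` — the slice identity
  `∫⟪-div G, ψ⟫ = Σᵢⱼ ∫ Gᵢⱼ ∂ⱼψᵢ` for integrable `C¹` `ψ` with integrable derivative;
* `intervalIntegral_inner_negMatrixDiv_heatTest_eq_neg_sum_oseenDuhamel` — the time-integrated
  identity `∫₀ᵗ∫⟪f, e^{ν(t-τ)Δ}φ⟫ = -Σ_{(i,j)} ∫⟪B^ν_0(eⱼ, Gᵢⱼeᵢ)(t), φ⟫` for `t ∈ (0, T]` and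
  divergence-free test fields `φ` (the duality form `integral_inner_oseenDuhamel_of_isDivFree` of
  each pair).

## References

* M. P. Coiculescu, S. Palasek, Invent. Math. 244 (2025) = arXiv:2503.14699, §4.1 (4.1), §5 ¶1.
  [`CoiculescuPalasek2025`]
* G. Koch, N. Nadirashvili, G. Seregin, V. Šverák, Acta Math. 203 (2009) = arXiv:0709.3599, §4
  p. 8 (the Oseen kernel form of `∫ e^{(t-τ)Δ}ℙ∇·(u ⊗ v)`). [`KochNadirashviliSereginSverak2009`]
-/

noncomputable section

open MeasureTheory Set Function Filter TopologicalSpace InnerProductSpace Metric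
open _root_.Topology
open scoped RealInnerProductSpace NNReal ENNReal

namespace Literature.Analysis.FluidPDE

variable {d : Type*} [Fintype d] [DecidableEq d]

omit [DecidableEq d] in
/-- **Whole-space integration by parts with one bounded factor**: for a `C¹` scalar `g` with
`|g| ≤ M_g`, `|∂ᵥg| ≤ M_g'` and a `C¹` integrable scalar `h` with integrable directional derivative
`∂ᵥh`, `∫ ∂ᵥg · h = -∫ g · ∂ᵥh` (Mathlib's `integral_mul_fderiv_eq_neg_fderiv_mul_of_integrable`;
the three products are bounded × integrable). [folklore] -/
theorem integral_fderiv_mul_eq_neg_of_bounded {g h : EuclideanSpace ℝ d → ℝ} {Mg Mg' : ℝ}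
    (v : EuclideanSpace ℝ d) (hg : Differentiable ℝ g) (hgM : ∀ y, |g y| ≤ Mg)
    (hgM' : ∀ y, |fderiv ℝ g y v| ≤ Mg') (hh : Differentiable ℝ h) (hhi : Integrable h)
    (hh'i : Integrable fun y => fderiv ℝ h y v) :
    ∫ y, fderiv ℝ g y v * h y = -∫ y, g y * fderiv ℝ h y v := by
  have hgm : AEStronglyMeasurable g volume := hg.continuous.aestronglyMeasurable
  have hg'm : AEStronglyMeasurable (fun y => fderiv ℝ g y v) volume :=
    (measurable_fderiv_apply_const ℝ g v).aestronglyMeasurable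
  have hgb : ∀ᵐ y ∂(volume : Measure (EuclideanSpace ℝ d)), ‖g y‖ ≤ Mg :=
    Eventually.of_forall fun y => by rw [Real.norm_eq_abs]; exact hgM y
  have hg'b : ∀ᵐ y ∂(volume : Measure (EuclideanSpace ℝ d)), ‖fderiv ℝ g y v‖ ≤ Mg' :=
    Eventually.of_forall fun y => by rw [Real.norm_eq_abs]; exact hgM' y
  have h1 : Integrable (fun y => fderiv ℝ g y v * h y) := hhi.bdd_mul hg'm hg'b
  have h2 : Integrable (fun y => g y * fderiv ℝ h y v) := hh'i.bdd_mul hgm hgb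
  have h3 : Integrable (fun y => g y * h y) := hhi.bdd_mul hgm hgb
  have h := integral_mul_fderiv_eq_neg_fderiv_mul_of_integrable h1 h2 h3
    (fun y _ => hg y) (fun y _ => hh y)
  rw [h, neg_neg]

/-- **The slice identity `∫⟪-div G, ψ⟫ = Σᵢⱼ ∫ Gᵢⱼ ∂ⱼψᵢ`**: for a `C¹` tensor field `G` on `ℝ^d`
with `|Gᵢⱼ| ≤ M_g`, `|∂ⱼGᵢⱼ| ≤ M_g'`, and a `C¹` integrable vector field `ψ` with integrable
derivative, the force `-div G`, `(-div G)ᵢ = -Σⱼ ∂ⱼGᵢⱼ`, satisfies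
`∫⟪-div G, ψ⟫ = Σᵢ Σⱼ ∫ Gᵢⱼ (∂ⱼψ)ᵢ` (integration by parts in `yⱼ`, no boundary terms).
[cite: CoiculescuPalasek2025, §4.1 eq. (4.1) (the force -ℙ div F)] -/
theorem integral_inner_negMatrixDiv_eq_sum {G : EuclideanSpace ℝ d → d → d → ℝ} {Mg Mg' : ℝ}
    {ψ : EuclideanSpace ℝ d → EuclideanSpace ℝ d}
    (hGd : ∀ i j, Differentiable ℝ fun y => G y i j) (hGM : ∀ y i j, |G y i j| ≤ Mg)
    (hGM' : ∀ y i j, |fderiv ℝ (fun z => G z i j) y (EuclideanSpace.single j (1 : ℝ))| ≤ Mg')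
    (hψd : Differentiable ℝ ψ) (hψi : Integrable ψ)
    (hψ'i : Integrable fun y => fderiv ℝ ψ y) :
    ∫ y, ⟪-(WithLp.toLp 2 fun i => ∑ j,
        fderiv ℝ (fun z => G z i j) y (EuclideanSpace.single j (1 : ℝ))), ψ y⟫ =
      ∑ i, ∑ j, ∫ y, G y i j * fderiv ℝ ψ y (EuclideanSpace.single j (1 : ℝ)) i := by
  -- components of `ψ` and of `Dψ`
  have hψc : ∀ i, Integrable (fun y => ψ y i) := fun i =>
    (EuclideanSpace.proj i : EuclideanSpace ℝ d →L[ℝ] ℝ).integrable_comp hψi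
  have hψcd : ∀ i, Differentiable ℝ (fun y => ψ y i) := fun i =>
    (EuclideanSpace.proj i : EuclideanSpace ℝ d →L[ℝ] ℝ).differentiable.comp hψd
  have hfd : ∀ i y (v : EuclideanSpace ℝ d), fderiv ℝ (fun z => ψ z i) y v = fderiv ℝ ψ y v i := by
    intro i y v
    have h := ((EuclideanSpace.proj i : EuclideanSpace ℝ d →L[ℝ] ℝ).hasFDerivAt.comp y
      (hψd y).hasFDerivAt).fderiv
    change fderiv ℝ ((EuclideanSpace.proj i : EuclideanSpace ℝ d →L[ℝ] ℝ) ∘ ψ) y v = _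
    rw [h]
    rfl
  have hψ'c : ∀ i (v : EuclideanSpace ℝ d), Integrable (fun y => fderiv ℝ (fun z => ψ z i) y v) := by
    intro i v
    have h := (((EuclideanSpace.proj i : EuclideanSpace ℝ d →L[ℝ] ℝ).comp
      (ContinuousLinearMap.apply ℝ (EuclideanSpace ℝ d) v))).integrable_comp hψ'i
    refine h.congr (Eventually.of_forall fun y => ?_)
    simp only [ContinuousLinearMap.coe_comp, Function.comp_apply, ContinuousLinearMap.apply_apply]
    rw [hfd]
    rfl
  -- the pointwise form of the integrand
  have hpt : ∀ y, ⟪-(WithLp.toLp 2 fun i => ∑ j,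
      fderiv ℝ (fun z => G z i j) y (EuclideanSpace.single j (1 : ℝ))), ψ y⟫ =
      -∑ i, ∑ j, fderiv ℝ (fun z => G z i j) y (EuclideanSpace.single j (1 : ℝ)) * ψ y i := by
    intro y
    rw [inner_neg_left, PiLp.inner_apply]
    congr 1
    refine Finset.sum_congr rfl fun i _ => ?_
    simp only [RCLike.inner_apply, conj_trivial]
    rw [Finset.mul_sum]
    refine Finset.sum_congr rfl fun j _ => ?_
    ring
  -- each term is integrable (bounded × integrable)
  have hterm : ∀ i j, Integrable (fun y =>
      fderiv ℝ (fun z => G z i j) y (EuclideanSpace.single j (1 : ℝ)) * ψ y i) := by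
    intro i j
    refine (hψc i).bdd_mul
      (measurable_fderiv_apply_const ℝ (fun z => G z i j) _).aestronglyMeasurable
      (Eventually.of_forall fun y => by rw [Real.norm_eq_abs]; exact hGM' y i j)
  simp_rw [hpt]
  rw [integral_neg, integral_finsetSum _ (fun i _ => integrable_finsetSum _ (fun j _ => hterm i j))]
  rw [← Finset.sum_neg_distrib]
  refine Finset.sum_congr rfl fun i _ => ?_
  rw [integral_finsetSum _ (fun j _ => hterm i j), ← Finset.sum_neg_distrib]
  refine Finset.sum_congr rfl fun j _ => ?_
  rw [integral_fderiv_mul_eq_neg_of_bounded (EuclideanSpace.single j (1 : ℝ)) (hGd i j)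
    (fun y => hGM y i j) (fun y => hGM' y i j) (hψcd i) (hψc i) (hψ'c i _), neg_neg]
  refine integral_congr_ae (Eventually.of_forall fun y => ?_)
  simp only
  rw [hfd]

/-- **The tested divergence force equals minus the sum of the tested Oseen–Duhamel pairs
`B^ν_0(eⱼ, Gᵢⱼ eᵢ)`.** Let `ν > 0` and let `G : (0,T) × ℝ^d → ℝ^{d×d}` be jointly measurable,
`C¹` in space on each slice, with `|Gᵢⱼ| ≤ M_g` and `|∂ⱼGᵢⱼ| ≤ M_g'`; let `f = -div G` on
`(0,T) × ℝ^d`. Then for `t ∈ (0, T]` and every divergence-free test field `φ`,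
`∫₀ᵗ ∫⟪f(τ), e^{ν(t-τ)Δ}φ⟫ dτ = -Σ_{(i,j)} ∫⟪B^ν_0(eⱼ, Gᵢⱼ eᵢ)(t), φ⟫` — the forcing term of the
duality (very weak) formulation written with the Oseen tensor (for each pair,
`∫⟪B^ν_0(a,b)(t), φ⟫ = -∫₀ᵗ∫⟪b, D(e^{ν(t-τ)Δ}φ) a⟫`, and `Σᵢⱼ Gᵢⱼ (∂ⱼψ)ᵢ` is `∫⟪-div G, ψ⟫` after an
integration by parts). This is the form in which the residual force `-ℙ div F⁽ⁱ⁾` of (4.1) enters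
the mild formulation of §5.
[cite: CoiculescuPalasek2025, §4.1 eq. (4.1) and §5 ¶1; KochNadirashviliSereginSverak2009, §4 p. 8] -/
theorem intervalIntegral_inner_negMatrixDiv_heatTest_eq_neg_sum_oseenDuhamel
    {ν T Mg Mg' : ℝ} {G : ℝ → EuclideanSpace ℝ d → d → d → ℝ}
    {f : ℝ → EuclideanSpace ℝ d → EuclideanSpace ℝ d} (hν : 0 < ν)
    (hGm : ∀ i j, Measurable fun p : ℝ × EuclideanSpace ℝ d => G p.1 p.2 i j)
    (hGd : ∀ τ ∈ Ioo 0 T, ∀ i j, Differentiable ℝ fun y => G τ y i j)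
    (hGM : ∀ τ ∈ Ioo 0 T, ∀ y i j, |G τ y i j| ≤ Mg)
    (hGM' : ∀ τ ∈ Ioo 0 T, ∀ y i j,
      |fderiv ℝ (fun z => G τ z i j) y (EuclideanSpace.single j (1 : ℝ))| ≤ Mg')
    (hf : ∀ τ ∈ Ioo 0 T, ∀ y, f τ y = -(WithLp.toLp 2 fun i => ∑ j,
      fderiv ℝ (fun z => G τ z i j) y (EuclideanSpace.single j (1 : ℝ))))
    {t : ℝ} (ht : t ∈ Ioc 0 T) {φ : EuclideanSpace ℝ d → EuclideanSpace ℝ d}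
    (hφ : FunctionSpaces.IsTestFunctionOn (⊤ : Opens (EuclideanSpace ℝ d)) φ)
    (hdiv : VectorCalculus.IsDivFree φ) :
    (∫ τ in (0 : ℝ)..t, ∫ y, ⟪f τ y, heatTest ν φ (t - τ) y⟫) =
      -∑ p : d × d, ∫ y, ⟪oseenDuhamel ν 0 (fun _ _ => EuclideanSpace.single p.2 (1 : ℝ))
          (fun τ z => G τ z p.1 p.2 • EuclideanSpace.single p.1 (1 : ℝ)) t y, φ y⟫ := by
  haveI : CompleteSpace (EuclideanSpace ℝ d) := FiniteDimensional.complete ℝ _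
  set ψ : ℝ → EuclideanSpace ℝ d → EuclideanSpace ℝ d := fun τ =>
    UnboundedOperators.heatExtension φ (ν * (t - τ)) with hψ
  -- the tested pair integrands
  set P : d × d → ℝ → ℝ := fun p τ =>
    ∫ y, G τ y p.1 p.2 * fderiv ℝ (ψ τ) y (EuclideanSpace.single p.2 (1 : ℝ)) p.1 with hP
  have hφi : Integrable φ := hφ.contDiff.continuous.integrable_of_hasCompactSupport hφ.hasCompactSupport
  have hφ1 : ContDiff ℝ 1 φ := hφ.contDiff.of_le (by exact_mod_cast le_top)
  have hφ'i : Integrable (fun y => fderiv ℝ φ y) :=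
    (hφ1.continuous_fderiv one_ne_zero).integrable_of_hasCompactSupport
      (hφ.hasCompactSupport.fderiv ℝ)
  -- properties of the caloric test field on `(0, t)`
  have hψd : ∀ τ, τ < t → Differentiable ℝ (ψ τ) := fun τ hτ =>
    (UnboundedOperators.contDiff_heatExtension_of_hasCompactSupport hφ1 hφ.hasCompactSupport _).differentiable
      one_ne_zero
  have hψi : ∀ τ, τ < t → Integrable (ψ τ) := fun τ hτ =>
    UnboundedOperators.integrable_heatExtension hφi (mul_pos hν (sub_pos.2 hτ))
  have hψ'i : ∀ τ, τ < t → Integrable (fun y => fderiv ℝ (ψ τ) y) := by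
    intro τ hτ
    have h := UnboundedOperators.integrable_heatExtension hφ'i (mul_pos hν (sub_pos.2 hτ))
    refine h.congr (Eventually.of_forall fun y => ?_)
    exact (UnboundedOperators.fderiv_heatExtension_of_hasCompactSupport hφ1 hφ.hasCompactSupport _ y).symm
  -- each pair in duality form
  have hpair : ∀ p : d × d,
      IntegrableOn (P p) (Ioo 0 t) ∧
      ∫ y, ⟪oseenDuhamel ν 0 (fun _ _ => EuclideanSpace.single p.2 (1 : ℝ))
          (fun τ z => G τ z p.1 p.2 • EuclideanSpace.single p.1 (1 : ℝ)) t y, φ y⟫ =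
        -∫ τ in Ioo 0 t, P p τ := by
    intro p
    have hu : AEStronglyMeasurable (uncurry fun (_ : ℝ) (_ : EuclideanSpace ℝ d) =>
        EuclideanSpace.single p.2 (1 : ℝ))
        ((volume : Measure (ℝ × EuclideanSpace ℝ d)).restrict (Ioo 0 T ×ˢ univ)) :=
      aestronglyMeasurable_const
    have hv : AEStronglyMeasurable (uncurry fun τ (z : EuclideanSpace ℝ d) =>
        G τ z p.1 p.2 • EuclideanSpace.single p.1 (1 : ℝ))
        ((volume : Measure (ℝ × EuclideanSpace ℝ d)).restrict (Ioo 0 T ×ˢ univ)) :=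
      ((hGm p.1 p.2).smul_const _).aestronglyMeasurable
    have hM : (0 : ℝ) ≤ max 1 Mg := le_max_of_le_left zero_le_one
    have huM : ∀ τ ∈ Ioo 0 T, ∀ y : EuclideanSpace ℝ d,
        ‖(fun (_ : ℝ) (_ : EuclideanSpace ℝ d) => EuclideanSpace.single p.2 (1 : ℝ)) τ y‖ ≤ max 1 Mg := by
      intro τ _ y
      simp only [PiLp.norm_single, norm_one]
      exact le_max_left _ _
    have hvM : ∀ τ ∈ Ioo 0 T, ∀ y : EuclideanSpace ℝ d,
        ‖(fun τ (z : EuclideanSpace ℝ d) => G τ z p.1 p.2 • EuclideanSpace.single p.1 (1 : ℝ)) τ y‖ ≤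
          max 1 Mg := by
      intro τ hτ y
      simp only [norm_smul, PiLp.norm_single, norm_one, mul_one, Real.norm_eq_abs]
      exact (hGM τ hτ y p.1 p.2).trans (le_max_right _ _)
    obtain ⟨hint, heq⟩ := integral_inner_oseenDuhamel_of_isDivFree hν hu hv hM huM hvM ht.1 ht.2 hφ hdiv
    -- simplify the duality integrand to `G * (Dψ eⱼ)ᵢ`
    have hsimp : ∀ τ (y : EuclideanSpace ℝ d),
        ⟪G τ y p.1 p.2 • EuclideanSpace.single p.1 (1 : ℝ),
          fderiv ℝ (UnboundedOperators.heatExtension φ (ν * (t - τ))) y (EuclideanSpace.single p.2 (1 : ℝ))⟫ =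
        G τ y p.1 p.2 * fderiv ℝ (ψ τ) y (EuclideanSpace.single p.2 (1 : ℝ)) p.1 := by
      intro τ y
      rw [real_inner_smul_left, EuclideanSpace.inner_single_left]
      simp [hψ]
    have hprod : (volume : Measure (ℝ × EuclideanSpace ℝ d)).restrict (Ioo 0 t ×ˢ univ) =
        ((volume : Measure ℝ).restrict (Ioo 0 t)).prod (volume : Measure (EuclideanSpace ℝ d)) := by
      conv_rhs => rw [← Measure.restrict_univ (μ := (volume : Measure (EuclideanSpace ℝ d)))]
      rw [Measure.prod_restrict]
      rfl
    rw [hprod] at hint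
    have hint' := hint.integral_prod_left
    refine ⟨?_, ?_⟩
    · refine (hint'.congr (Eventually.of_forall fun τ => ?_))
      simp only [hP]
      exact integral_congr_ae (Eventually.of_forall fun y => hsimp τ y)
    · rw [heq]
      congr 1
      refine integral_congr_ae (Eventually.of_forall fun τ => ?_)
      exact integral_congr_ae (Eventually.of_forall fun y => hsimp τ y)
  -- the left-hand side, slice by slice
  have hslice : ∀ τ ∈ Ioo 0 t, ∫ y, ⟪f τ y, heatTest ν φ (t - τ) y⟫ = ∑ i, ∑ j, P (i, j) τ := by
    intro τ hτ
    have hτT : τ ∈ Ioo 0 T := ⟨hτ.1, hτ.2.trans_le ht.2⟩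
    rw [heatTest_of_pos hν (sub_pos.2 hτ.2)]
    have h := integral_inner_negMatrixDiv_eq_sum (hGd τ hτT) (hGM τ hτT) (hGM' τ hτT)
      (hψd τ hτ.2) (hψi τ hτ.2) (hψ'i τ hτ.2)
    have hfun : (fun y => ⟪f τ y, UnboundedOperators.heatExtension φ (ν * (t - τ)) y⟫) = fun y =>
        ⟪-(WithLp.toLp 2 fun i => ∑ j,
          fderiv ℝ (fun z => G τ z i j) y (EuclideanSpace.single j (1 : ℝ))), ψ τ y⟫ := by
      funext y; rw [hf τ hτT y]
    rw [hfun, h]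
  rw [intervalIntegral.integral_of_le ht.1.le, integral_Ioc_eq_integral_Ioo,
    setIntegral_congr_fun measurableSet_Ioo hslice,
    integral_finsetSum _ (fun i _ => integrable_finsetSum _ (fun j _ => (hpair (i, j)).1))]
  simp_rw [integral_finsetSum _ (fun j _ => (hpair (_, j)).1)]
  rw [Fintype.sum_prod_type, ← Finset.sum_neg_distrib]
  refine Finset.sum_congr rfl fun i _ => ?_
  rw [← Finset.sum_neg_distrib]
  refine Finset.sum_congr rfl fun j _ => ?_
  rw [(hpair (i, j)).2, neg_neg]

end Literature.Analysis.FluidPDE
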